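import Literature.AlgebraicTopology.SingularHomology.ChainSubcomplex
import HarnessLib

/-!
# Homology isomorphisms glue along jointly bijective restriction families

An elementary device for "disjoint union" steps in bootstrap arguments (Bredon,
*Topology and Geometry* (1993), §V.9, property (3) of the bootstrap lemma: additivity of `P`
under disjoint unions): let `φ : K ⟶ L` be a morphism of complexes of modules and
`φᵢ : Kᵢ ⟶ Lᵢ` a family of morphisms, together with "restriction" morphisms `K ⟶ Kᵢ`,
`L ⟶ Lᵢ` compatible with `φ, φᵢ`, such that in every degree the joint restriction maps
`K_n → Πᵢ (Kᵢ)_n` and `L_n → Πᵢ (Lᵢ)_n` are bijective (so that `K ≅ Πᵢ Kᵢ`, `L ≅ Πᵢ Lᵢ`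
degreewise, compatibly with the differentials). If every `H_j(φᵢ)` is an isomorphism then so
is `H_j(φ)` (`isIso_homologyMap_of_jointly_bijective`). The proof is the evident element chase
(products of modules are exact), via the tree's criteria `homologyMap_injective_iff` /
`homologyMap_surjective_iff`.

## References

* G. E. Bredon, *Topology and Geometry*, GTM 139 (1993), §V.9.
-/

open CategoryTheory

universe u w t s

namespace Literature.Algebra.Homology

open Literature.AlgebraicTopology.SingularHomology

variable {R : Type u} [CommRing R] {ι' : Type t} {c : ComplexShape ι'} {ι : Type s}
  {K L : HomologicalComplex (ModuleCat.{w} R) c} (φ : K ⟶ L)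
  {K' L' : ι → HomologicalComplex (ModuleCat.{w} R) c} (φ' : ∀ i, K' i ⟶ L' i)
  (rK : ∀ i, K ⟶ K' i) (rL : ∀ i, L ⟶ L' i)

/-- Element form of the commutation of a chain map with the differentials. [folklore] -/
theorem hom_f_d_apply {K₁ K₂ : HomologicalComplex (ModuleCat.{w} R) c} (f : K₁ ⟶ K₂) (i j : ι')
    (x : K₁.X i) : f.f j (K₁.d i j x) = K₂.d i j (f.f i x) := by
  rw [← ModuleCat.comp_apply, ← f.comm i j, ModuleCat.comp_apply]

/-- **Homology isomorphisms glue along jointly bijective restriction families** (the "disjoint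
union" step of Bredon's bootstrap, §V.9): if the joint restrictions `K_n → Πᵢ (Kᵢ)_n`,
`L_n → Πᵢ (Lᵢ)_n` are bijective in every degree and compatible with `φ`, `φᵢ`, and every
`H_j(φᵢ)` is an isomorphism, then `H_j(φ)` is an isomorphism. [cite: Bredon1993, §V.9] -/
theorem isIso_homologyMap_of_jointly_bijective (hcomm : ∀ i, rK i ≫ φ' i = φ ≫ rL i)
    (hK : ∀ n, Function.Bijective fun (x : K.X n) (i : ι) ↦ (rK i).f n x)
    (hL : ∀ n, Function.Bijective fun (x : L.X n) (i : ι) ↦ (rL i).f n x)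
    (j : ι') (h : ∀ i, IsIso (HomologicalComplex.homologyMap (φ' i) j)) :
    IsIso (HomologicalComplex.homologyMap φ j) := by
  have hcomm' : ∀ i n (x : K.X n), (φ' i).f n ((rK i).f n x) = (rL i).f n (φ.f n x) := fun i n x ↦ by
    rw [← ModuleCat.comp_apply, ← HomologicalComplex.comp_f, hcomm i, HomologicalComplex.comp_f,
      ModuleCat.comp_apply]
  refine (ConcreteCategory.isIso_iff_bijective _).2 ⟨?_, ?_⟩
  · -- injectivity
    refine (homologyMap_injective_iff φ).2 fun z hz hb ↦ ?_
    obtain ⟨w, hw⟩ := hb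
    have hyi : ∀ i, ∃ y : (K' i).X (c.prev j), (K' i).d (c.prev j) j y = (rK i).f j z := fun i ↦ by
      refine (homologyMap_injective_iff (φ' i)).1
        ((ConcreteCategory.isIso_iff_bijective _).1 (h i)).1 _ ?_ ⟨(rL i).f _ w, ?_⟩
      · rw [← hom_f_d_apply, hz, map_zero]
      · rw [← hom_f_d_apply, hw, hcomm']
    choose y hy using hyi
    obtain ⟨Y, hY⟩ := (hK (c.prev j)).2 y
    refine ⟨Y, (hK j).1 (funext fun i ↦ ?_)⟩
    change (rK i).f j (K.d (c.prev j) j Y) = (rK i).f j z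
    rw [hom_f_d_apply, show (rK i).f (c.prev j) Y = y i from congrFun hY i, hy]
  · -- surjectivity
    refine (homologyMap_surjective_iff φ).2 fun ψ hψ ↦ ?_
    have hxi : ∀ i, ∃ (x : (K' i).X j) (_ : (K' i).d j (c.next j) x = 0) (w : (L' i).X (c.prev j)),
        (L' i).d (c.prev j) j w = (rL i).f j ψ - (φ' i).f j x := fun i ↦ by
      refine (homologyMap_surjective_iff (φ' i)).1
        ((ConcreteCategory.isIso_iff_bijective _).1 (h i)).2 _ ?_
      rw [← hom_f_d_apply, hψ, map_zero]
    choose x hx w hw using hxi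
    obtain ⟨Xg, hXg⟩ := (hK j).2 x
    obtain ⟨Wg, hWg⟩ := (hL (c.prev j)).2 w
    have hXi : ∀ i, (rK i).f j Xg = x i := fun i ↦ congrFun hXg i
    have hWi : ∀ i, (rL i).f (c.prev j) Wg = w i := fun i ↦ congrFun hWg i
    refine ⟨Xg, (hK (c.next j)).1 (funext fun i ↦ ?_), Wg, (hL j).1 (funext fun i ↦ ?_)⟩
    · change (rK i).f _ (K.d j (c.next j) Xg) = (rK i).f _ 0
      rw [hom_f_d_apply, hXi, hx, map_zero]
    · change (rL i).f j (L.d (c.prev j) j Wg) = (rL i).f j (ψ - φ.f j Xg)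
      rw [hom_f_d_apply, hWi, hw, map_sub, ← hcomm', hXi]

end Literature.Algebra.Homology
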